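import Mathlib.Analysis.SpecialFunctions.Log.PosLog
import Mathlib.MeasureTheory.Integral.IntegralEqImproper
import Literature.Analysis.Complex.SlitHalfStripPoisson
import HarnessLib

/-!
# `WindowStep`, line `split-birth` — stub `stub_logIntegrability`

Support file for the crux `stmt-RiemannHypothesis-14659`
(`Summit.RiemannHypothesis.RiemannHypothesis.Theses.SpectralTrace.WindowStep`), line
`split-birth`. Pure complex analysis: the `log⁻` half of "an entire function of exponential type
bounded on the real axis lies in the Cartwright class" (Boas, *Entire Functions*, §6.6–7.2;
Koosis, *The Logarithmic Integral I*, §III.G.2):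

* `stub_logIntegrability` : if `F` is entire, `‖F z‖ ≤ K e^{B |Im z|}` (`K ≥ 1`, `B ≥ 0`) and
  `F c ≠ 0` for some real `c`, then `x ↦ log⁺(1/|F(x)|)/(1+x²)` is integrable on `ℝ`.

Proof. `G(z) = F(z) e^{iBz}` is entire and bounded by `K` on the closed upper half-plane, and
`G(c + it) ≠ 0` for some `t > 0` (continuity). Composing `G` with the Cayley map
`ξ ↦ c + i t (1+ξ)/(1-ξ)` of the unit disc onto the upper half-plane (centre `↦ c + it`, boundary
`e^{iθ} ↦ c - t cot(θ/2)`), the tree's regularised sub-mean-value inequality on the unit disc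
`Literature.Analysis.Complex.log_normSq_add_le_circleAverage_unitDisc` and the change of variables
`Literature.Analysis.Complex.integral_comp_cotHalf` give, for every `ε > 0`,
`π log(|G(c+it)|² + ε) ≤ ∫ log(|F(c - tσ)|² + ε) dσ/(1+σ²)`.
Splitting `log = log⁺ - log⁺(·⁻¹)` and bounding `log⁺(|F|² + ε) ≤ log⁺(K² + 1)` (`ε ≤ 1`) yields the
`ε`-uniform bound `∫ log⁺((|F(c-tσ)|² + ε)⁻¹) dσ/(1+σ²) ≤ π log⁺(K²+1) - π log|G(c+it)|²`, and
Fatou's lemma (`ε = 1/(n+1) → 0`; at real zeros of `F` the limit integrand is `0 ≤ liminf`) gives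
the integrability of `σ ↦ log⁺(1/|F(c - tσ)|)/(1+σ²)`; the affine change of variables
`x = c - tσ` with the comparison `1 + ((c-x)/t)² ≤ (1 + (2c²+2)/t²)(1 + x²)` finishes.
-/

set_option linter.dupNamespace false

noncomputable section

open Set MeasureTheory Filter Metric
open scoped Real Topology

namespace Summit.RiemannHypothesis.RiemannHypothesis.Theorems.SpectralTraceWindowStep

open Literature.Analysis.Complex

/-! ### The Cayley map of the disc onto the upper half-plane based at `c + it` -/

/-- `Im (c + i t q(ξ)) = t · Re q(ξ)`. [folklore] -/
theorem im_cayley_center (c t : ℝ) (ξ : ℂ) :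
    ((c : ℂ) + (t : ℂ) * Complex.I * cayleyQ ξ).im = t * (cayleyQ ξ).re := by
  simp

/-- The boundary values of the Cayley map based at `c + it` are real: for `θ ∈ (0, 2π)`,
`c + i t q(e^{iθ}) = c - t cot(θ/2)`. [folklore] -/
theorem cayley_center_circleMap {c t θ : ℝ} (hθ : θ ∈ Ioo 0 (2 * π)) :
    (c : ℂ) + (t : ℂ) * Complex.I * cayleyQ (circleMap 0 1 θ) = ((c - t * cotHalf θ : ℝ) : ℂ) := by
  rw [cayleyQ_circleMap (circleMap_ne_one hθ), bdrySigma_eq_cotHalf hθ]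
  have h : (t : ℂ) * Complex.I * ((cotHalf θ : ℝ) * Complex.I) =
      (t : ℂ) * (cotHalf θ : ℝ) * (Complex.I * Complex.I) := by ring
  rw [h, Complex.I_mul_I]
  push_cast
  ring

/-- The centre goes to `c + it`: `c + i t q(0) = c + it`. [folklore] -/
theorem cayley_center_zero (c t : ℝ) :
    (c : ℂ) + (t : ℂ) * Complex.I * cayleyQ 0 = (c : ℂ) + (t : ℂ) * Complex.I := by
  simp [cayleyQ]

/-- **Regularised Poisson–Jensen inequality for the upper half-plane.** For `G` entire and bounded
by `K` on the open upper half-plane, `c ∈ ℝ`, `t > 0` and `ε > 0`: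
`log(|G(c+it)|² + ε) ≤ π⁻¹ ∫ log(|G(c - tσ)|² + ε) dσ/(1+σ²)` (the unit-disc sub-mean-value
inequality transported by the Cayley map, `dθ/(2π) ↦ dσ/(π(1+σ²))`). [folklore] -/
theorem log_normSq_add_le_upperHalfPlane {G : ℂ → ℂ} (hG : Differentiable ℂ G) {K : ℝ}
    (hK : ∀ z : ℂ, 0 < z.im → ‖G z‖ ≤ K) (c : ℝ) {t ε : ℝ} (ht : 0 < t) (hε : 0 < ε) :
    Real.log (‖G ((c : ℂ) + (t : ℂ) * Complex.I)‖ ^ 2 + ε) ≤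
      π⁻¹ * ∫ σ, Real.log (‖G ((c - t * σ : ℝ) : ℂ)‖ ^ 2 + ε) / (1 + σ ^ 2) := by
  set Ψ : ℂ → ℂ := fun ξ => (c : ℂ) + (t : ℂ) * Complex.I * cayleyQ ξ with hΨ
  have hΨd : ∀ ξ : ℂ, ξ ≠ 1 → DifferentiableAt ℂ Ψ ξ := fun ξ hξ =>
    (differentiableAt_const _).add ((differentiableAt_const _).mul (differentiableAt_cayleyQ hξ))
  have hball1 : ∀ ξ ∈ ball (0 : ℂ) 1, ξ ≠ 1 := by
    intro ξ hξ h
    rw [h] at hξ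
    simp at hξ
  have hg : DifferentiableOn ℂ (fun ξ => G (Ψ ξ)) (ball 0 1) := fun ξ hξ =>
    ((hG _).comp ξ (hΨd ξ (hball1 ξ hξ))).differentiableWithinAt
  have hcont : ContinuousOn (fun ξ => G (Ψ ξ)) (closedBall 0 1 \ {1}) := fun ξ hξ =>
    ((hG.continuous.continuousAt).comp (hΨd ξ hξ.2).continuousAt).continuousWithinAt
  have hM : ∀ ξ ∈ ball (0 : ℂ) 1, ‖G (Ψ ξ)‖ ≤ K := by
    intro ξ hξ
    apply hK
    have hn : ‖ξ‖ < 1 := by simpa using hξ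
    rw [hΨ, im_cayley_center]
    exact mul_pos ht (re_cayleyQ_pos hn)
  have h := log_normSq_add_le_circleAverage_unitDisc (Set.finite_singleton (1 : ℂ)) hg hcont hM hε
  rw [show Ψ 0 = (c : ℂ) + (t : ℂ) * Complex.I from cayley_center_zero c t] at h
  refine h.trans (le_of_eq ?_)
  rw [Real.circleAverage_def, smul_eq_mul, intervalIntegral.integral_of_le Real.two_pi_pos.le,
    integral_Ioc_eq_integral_Ioo]
  have h1 : ∫ θ in Ioo 0 (2 * π), Real.log (‖G (Ψ (circleMap 0 1 θ))‖ ^ 2 + ε) =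
      ∫ θ in Ioo 0 (2 * π),
        (fun σ => Real.log (‖G ((c - t * σ : ℝ) : ℂ)‖ ^ 2 + ε)) (cotHalf θ) :=
    setIntegral_congr_fun measurableSet_Ioo fun θ hθ => by
      simp only [hΨ, cayley_center_circleMap hθ]
  rw [h1, integral_comp_cotHalf (fun σ => Real.log (‖G ((c - t * σ : ℝ) : ℂ)‖ ^ 2 + ε))]
  have h2 : (fun σ => 2 / (1 + σ ^ 2) * Real.log (‖G ((c - t * σ : ℝ) : ℂ)‖ ^ 2 + ε)) =
      fun σ => 2 * (Real.log (‖G ((c - t * σ : ℝ) : ℂ)‖ ^ 2 + ε) / (1 + σ ^ 2)) := by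
    funext σ; ring
  rw [h2, integral_const_mul]
  have hπ : (π : ℝ) ≠ 0 := Real.pi_pos.ne'
  field_simp

/-! ### The multiplier `e^{iBz}` -/

/-- `Re(iBz) = -B Im z`. [folklore] -/
theorem re_I_mul_mul (B : ℝ) (z : ℂ) : (Complex.I * B * z).re = -(B * z.im) := by
  simp [Complex.mul_re, Complex.mul_im]

/-- If `‖F z‖ ≤ K e^{B|Im z|}` then `G = F e^{iBz}` is bounded by `K` on the closed upper
half-plane. [folklore] -/
theorem norm_mul_exp_le {F : ℂ → ℂ} {K B : ℝ}
    (hFb : ∀ z : ℂ, ‖F z‖ ≤ K * Real.exp (B * |z.im|)) {z : ℂ} (hz : 0 ≤ z.im) :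
    ‖F z * Complex.exp (Complex.I * B * z)‖ ≤ K := by
  rw [norm_mul, Complex.norm_exp, re_I_mul_mul]
  have h := hFb z
  rw [abs_of_nonneg hz] at h
  calc ‖F z‖ * Real.exp (-(B * z.im)) ≤ K * Real.exp (B * z.im) * Real.exp (-(B * z.im)) :=
        mul_le_mul_of_nonneg_right h (Real.exp_pos _).le
    _ = K := by rw [mul_assoc, ← Real.exp_add, add_neg_cancel, Real.exp_zero, mul_one]

/-- On the real axis `|F(x) e^{iBx}| = |F(x)|`. [folklore] -/
theorem norm_mul_exp_ofReal (F : ℂ → ℂ) (B x : ℝ) :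
    ‖F x * Complex.exp (Complex.I * B * x)‖ = ‖F x‖ := by
  rw [norm_mul, Complex.norm_exp, re_I_mul_mul, Complex.ofReal_im, mul_zero, neg_zero,
    Real.exp_zero, mul_one]

/-! ### The `ε`-uniform bound on the Poisson integral of `log⁺((q + ε)⁻¹)` -/

/-- A continuous function bounded in absolute value by `C` is integrable against `dσ/(1+σ²)`.
[folklore] -/
theorem integrable_div_one_add_sq {u : ℝ → ℝ} (hu : Continuous u) {C : ℝ} (hC : ∀ σ, |u σ| ≤ C) :
    Integrable (fun σ => u σ / (1 + σ ^ 2)) := by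
  refine (integrable_inv_one_add_sq.const_mul C).mono' ?_ (ae_of_all _ fun σ => ?_)
  · exact (hu.div (by fun_prop) fun σ => by positivity).aestronglyMeasurable
  · have hpos : (0 : ℝ) < 1 + σ ^ 2 := by positivity
    rw [Real.norm_eq_abs, abs_div, abs_of_pos hpos, div_eq_mul_inv]
    exact mul_le_mul_of_nonneg_right (hC σ) (inv_pos.2 hpos).le

/-- **The `ε`-level bound.** Let `q : ℝ → ℝ` be continuous with `0 ≤ q ≤ Q`, `a > 0`,
`0 < ε ≤ 1`, and suppose `log(a + ε) ≤ π⁻¹ ∫ log(q σ + ε) dσ/(1+σ²)`. Then, splitting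
`log = log⁺ - log⁺(·⁻¹)`, `∫ log⁺((q σ + ε)⁻¹) dσ/(1+σ²) ≤ π log⁺(Q + 1) - π log a`. [folklore] -/
theorem integral_posLog_inv_le {q : ℝ → ℝ} (hq : Continuous q) {Q a ε : ℝ}
    (hq0 : ∀ σ, 0 ≤ q σ) (hqQ : ∀ σ, q σ ≤ Q) (ha : 0 < a) (hε : 0 < ε) (hε1 : ε ≤ 1)
    (h : Real.log (a + ε) ≤ π⁻¹ * ∫ σ, Real.log (q σ + ε) / (1 + σ ^ 2)) :
    ∫ σ, Real.posLog (q σ + ε)⁻¹ / (1 + σ ^ 2) ≤ π * Real.posLog (Q + 1) - π * Real.log a := by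
  have hqε : ∀ σ, 0 < q σ + ε := fun σ => by linarith [hq0 σ]
  -- the two halves are integrable
  have hb1 : ∀ σ, |Real.posLog (q σ + ε)| ≤ Real.posLog (Q + 1) := fun σ => by
    rw [abs_of_nonneg Real.posLog_nonneg]
    exact Real.posLog_le_posLog (hqε σ).le (by linarith [hqQ σ])
  have hI1 : Integrable (fun σ => Real.posLog (q σ + ε) / (1 + σ ^ 2)) :=
    integrable_div_one_add_sq (by fun_prop) hb1
  have hb2 : ∀ σ, |Real.posLog (q σ + ε)⁻¹| ≤ Real.posLog ε⁻¹ := fun σ => by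
    rw [abs_of_nonneg Real.posLog_nonneg]
    exact Real.posLog_le_posLog (inv_pos.2 (hqε σ)).le
      (inv_anti₀ hε (by linarith [hq0 σ]))
  have hI2 : Integrable (fun σ => Real.posLog (q σ + ε)⁻¹ / (1 + σ ^ 2)) :=
    integrable_div_one_add_sq
      (Real.continuous_posLog.comp ((hq.add continuous_const).inv₀ fun σ => (hqε σ).ne')) hb2
  -- the decomposition of the integral
  have hI : ∫ σ, Real.log (q σ + ε) / (1 + σ ^ 2) =
      (∫ σ, Real.posLog (q σ + ε) / (1 + σ ^ 2)) - ∫ σ, Real.posLog (q σ + ε)⁻¹ / (1 + σ ^ 2) := by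
    rw [← integral_sub hI1 hI2]
    refine integral_congr_ae (ae_of_all _ fun σ => ?_)
    simp only
    rw [← sub_div, Real.posLog_sub_posLog_inv]
  -- the bound on the `log⁺` half
  have hB1 : ∫ σ, Real.posLog (q σ + ε) / (1 + σ ^ 2) ≤ π * Real.posLog (Q + 1) := by
    have hm := integral_mono hI1 (integrable_inv_one_add_sq.const_mul (Real.posLog (Q + 1)))
      fun σ => by
        have hpos : (0 : ℝ) < 1 + σ ^ 2 := by positivity
        simp only
        rw [div_eq_mul_inv]
        exact mul_le_mul_of_nonneg_right ((le_abs_self _).trans (hb1 σ)) (inv_pos.2 hpos).le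
    rw [integral_const_mul, integral_univ_inv_one_add_sq] at hm
    linarith
  have hlog : Real.log a ≤ Real.log (a + ε) := Real.log_le_log ha (by linarith)
  have hπ := Real.pi_pos
  have h' : π * Real.log (a + ε) ≤ ∫ σ, Real.log (q σ + ε) / (1 + σ ^ 2) := by
    have := mul_le_mul_of_nonneg_left h hπ.le
    rwa [← mul_assoc, mul_inv_cancel₀ hπ.ne', one_mul] at this
  rw [hI] at h'
  nlinarith [mul_le_mul_of_nonneg_left hlog hπ.le]

/-! ### The passage `ε ↓ 0` (Fatou) -/

/-- **Fatou passage `ε = 1/(n+1) → 0`.** For `q : ℝ → ℝ` continuous and nonnegative, if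
`∫ log⁺((q σ + 1/(n+1))⁻¹) dσ/(1+σ²) ≤ M` for every `n`, then `σ ↦ log⁺((q σ)⁻¹)/(1+σ²)` is
integrable (at zeros of `q` the limit integrand is `log⁺ 0⁻¹ = 0`, below any `liminf`). [folklore] -/
theorem integrable_posLog_inv_of_bound {q : ℝ → ℝ} (hq : Continuous q) (hq0 : ∀ σ, 0 ≤ q σ)
    {M : ℝ} (hM : ∀ n : ℕ, ∫ σ, Real.posLog (q σ + 1 / ((n : ℝ) + 1))⁻¹ / (1 + σ ^ 2) ≤ M) :
    Integrable (fun σ => Real.posLog (q σ)⁻¹ / (1 + σ ^ 2)) := by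
  set f : ℕ → ℝ → ℝ := fun n σ => Real.posLog (q σ + 1 / ((n : ℝ) + 1))⁻¹ / (1 + σ ^ 2) with hf
  have hεpos : ∀ n : ℕ, (0 : ℝ) < 1 / ((n : ℝ) + 1) := fun n => by positivity
  have hqε : ∀ (n : ℕ) σ, 0 < q σ + 1 / ((n : ℝ) + 1) := fun n σ => by linarith [hq0 σ, hεpos n]
  have hfcont : ∀ n, Continuous (f n) := fun n =>
    (Real.continuous_posLog.comp ((hq.add continuous_const).inv₀ fun σ => (hqε n σ).ne')).div
      (by fun_prop) fun σ => by positivity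
  have hfnn : ∀ n σ, 0 ≤ f n σ := fun n σ => div_nonneg Real.posLog_nonneg (by positivity)
  have hfint : ∀ n, Integrable (f n) := fun n =>
    integrable_div_one_add_sq
      (Real.continuous_posLog.comp ((hq.add continuous_const).inv₀ fun σ => (hqε n σ).ne'))
      (C := Real.posLog (1 / ((n : ℝ) + 1))⁻¹) fun σ => by
        rw [abs_of_nonneg Real.posLog_nonneg]
        exact Real.posLog_le_posLog (inv_pos.2 (hqε n σ)).le
          (inv_anti₀ (hεpos n) (by linarith [hq0 σ]))
  have hlint : ∀ n, ∫⁻ σ, ENNReal.ofReal (f n σ) ≤ ENNReal.ofReal M := fun n => by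
    rw [← ofReal_integral_eq_lintegral_ofReal (hfint n) (ae_of_all _ (hfnn n))]
    exact ENNReal.ofReal_le_ofReal (hM n)
  set g : ℝ → ℝ := fun σ => Real.posLog (q σ)⁻¹ / (1 + σ ^ 2) with hg
  have hgm : Measurable g :=
    (Real.continuous_posLog.measurable.comp hq.measurable.inv).div (by fun_prop)
  have hgnn : ∀ σ, 0 ≤ g σ := fun σ => div_nonneg Real.posLog_nonneg (by positivity)
  -- pointwise Fatou comparison
  have hpt : ∀ σ, ENNReal.ofReal (g σ) ≤ liminf (fun n => ENNReal.ofReal (f n σ)) atTop := by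
    intro σ
    by_cases hqσ : q σ = 0
    · have : g σ = 0 := by simp [hg, hqσ]
      rw [this, ENNReal.ofReal_zero]
      exact bot_le
    · have htend : Tendsto (fun n => f n σ) atTop (𝓝 (g σ)) := by
        have h1 : Tendsto (fun n : ℕ => (1 : ℝ) / ((n : ℝ) + 1)) atTop (𝓝 0) :=
          tendsto_one_div_add_atTop_nhds_zero_nat
        have h2 : Tendsto (fun n : ℕ => q σ + 1 / ((n : ℝ) + 1)) atTop (𝓝 (q σ)) := by
          simpa using tendsto_const_nhds.add h1
        have h3 := (Real.continuous_posLog.tendsto _).comp (h2.inv₀ hqσ)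
        exact h3.div_const _
      rw [(ENNReal.tendsto_ofReal htend).liminf_eq]
  have hmeas : ∀ n, AEMeasurable (fun σ => ENNReal.ofReal (f n σ)) volume := fun n =>
    (hfcont n).measurable.ennreal_ofReal.aemeasurable
  have hfin : ∫⁻ σ, ENNReal.ofReal (g σ) < ⊤ :=
    calc ∫⁻ σ, ENNReal.ofReal (g σ)
        ≤ ∫⁻ σ, liminf (fun n => ENNReal.ofReal (f n σ)) atTop := lintegral_mono hpt
      _ ≤ liminf (fun n => ∫⁻ σ, ENNReal.ofReal (f n σ)) atTop := lintegral_liminf_le' hmeas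
      _ ≤ ENNReal.ofReal M := liminf_le_of_frequently_le' (Frequently.of_forall hlint)
      _ < ⊤ := ENNReal.ofReal_lt_top
  exact (lintegral_ofReal_ne_top_iff_integrable hgm.aestronglyMeasurable (ae_of_all _ hgnn)).1
    hfin.ne

/-! ### The affine change of variables `x = c - tσ` -/

/-- The Poisson weights at comparable points are comparable:
`1 + ((c-x)/t)² ≤ (1 + (2c²+2)/t²)(1 + x²)`. [folklore] -/
theorem one_add_sq_affine_le (c : ℝ) {t : ℝ} (ht : t ≠ 0) (x : ℝ) :
    1 + ((c - x) / t) ^ 2 ≤ (1 + (2 * c ^ 2 + 2) / t ^ 2) * (1 + x ^ 2) := by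
  have ht2 : 0 < t ^ 2 := by positivity
  refine le_of_mul_le_mul_left ?_ ht2
  have e1 : t ^ 2 * (1 + ((c - x) / t) ^ 2) = t ^ 2 + (c - x) ^ 2 := by
    field_simp
  have e2 : t ^ 2 * ((1 + (2 * c ^ 2 + 2) / t ^ 2) * (1 + x ^ 2)) =
      (t ^ 2 + (2 * c ^ 2 + 2)) * (1 + x ^ 2) := by
    field_simp
  rw [e1, e2]
  nlinarith [sq_nonneg (c + x), sq_nonneg x, sq_nonneg c, sq_nonneg (t * x)]

/-- **Affine change of variables in the Poisson integral.** For `P ≥ 0` measurable, `t ≠ 0`: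
if `σ ↦ P(c - tσ)/(1+σ²)` is integrable then so is `x ↦ P(x)/(1+x²)`. [folklore] -/
theorem integrable_div_one_add_sq_of_affine {P : ℝ → ℝ} (hP : Measurable P) (hP0 : ∀ x, 0 ≤ P x)
    (c : ℝ) {t : ℝ} (ht : t ≠ 0) (h : Integrable (fun σ => P (c - t * σ) / (1 + σ ^ 2))) :
    Integrable (fun x => P x / (1 + x ^ 2)) := by
  have h1 : Integrable (fun y => P (c - t * (y / t)) / (1 + (y / t) ^ 2)) := h.comp_div ht
  have h2 : Integrable (fun x => P (c - t * ((c - x) / t)) / (1 + ((c - x) / t) ^ 2)) :=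
    h1.comp_sub_left c
  have h3 : ∀ x, c - t * ((c - x) / t) = x := fun x => by field_simp; ring
  simp only [h3] at h2
  set A : ℝ := 1 + (2 * c ^ 2 + 2) / t ^ 2 with hA
  have hA0 : 0 ≤ A := by positivity
  refine (h2.const_mul A).mono' ((hP.div (by fun_prop)).aestronglyMeasurable)
    (ae_of_all _ fun x => ?_)
  have hw := one_add_sq_affine_le c ht x
  have hx : (0 : ℝ) < 1 + x ^ 2 := by positivity
  have hx' : (0 : ℝ) < 1 + ((c - x) / t) ^ 2 := by positivity
  rw [Real.norm_eq_abs, abs_of_nonneg (div_nonneg (hP0 x) hx.le)]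
  calc P x / (1 + x ^ 2) ≤ P x * A / (1 + ((c - x) / t) ^ 2) := by
        rw [div_le_div_iff₀ hx hx']
        calc P x * (1 + ((c - x) / t) ^ 2) ≤ P x * (A * (1 + x ^ 2)) :=
              mul_le_mul_of_nonneg_left hw (hP0 x)
          _ = P x * A * (1 + x ^ 2) := by ring
    _ = A * (P x / (1 + ((c - x) / t) ^ 2)) := by ring

/-! ### The stub -/

/-- **`stub_logIntegrability` (line `split-birth`, v2 stub 4a).** An entire function of exponential
type bounded on the real axis has Poisson-integrable `log⁻` on the axis: if `F` is entire,
`‖F z‖ ≤ K e^{B |Im z|}` (`K ≥ 1`, `B ≥ 0`) and `F c ≠ 0` for some real `c`, then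
`x ↦ log⁺(1/|F(x)|)/(1+x²)` is integrable on `ℝ` — the `log⁻` half of "exponential type and bounded
on `ℝ` implies Cartwright class" (Boas, *Entire Functions*, §6.6–7.2; Koosis, *The Logarithmic
Integral I*, §III.G.2), here by the elementary route: `G = F e^{iBz}` is bounded by `K` on the upper
half-plane, the Cayley map and the unit-disc sub-mean-value inequality give
`π log(|G(c+it)|² + ε) ≤ ∫ log(|F(c-tσ)|² + ε) dσ/(1+σ²)`, whence the `ε`-uniform bound
`∫ log⁺((|F(c-tσ)|² + ε)⁻¹) dσ/(1+σ²) ≤ π log⁺(K²+1) - π log|G(c+it)|²`, Fatou as `ε ↓ 0`, and the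
affine change of variables `x = c - tσ`. [folklore] -/
theorem stub_logIntegrability :
    ∀ (F : ℂ → ℂ) (K B : ℝ), Differentiable ℂ F → 1 ≤ K → 0 ≤ B →
      (∀ z : ℂ, ‖F z‖ ≤ K * Real.exp (B * |z.im|)) → (∃ c : ℝ, F (c : ℂ) ≠ 0) →
        MeasureTheory.Integrable (fun x : ℝ => Real.posLog ‖F (x : ℂ)‖⁻¹ / (1 + x ^ 2)) := by
  intro F K B hF _hK _hB hFb hc
  obtain ⟨c, hc⟩ := hc
  have hFc : Continuous F := hF.continuous
  -- Step 0: a point `c + it`, `t > 0`, with `F (c + it) ≠ 0`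
  obtain ⟨t, ht, hct⟩ : ∃ t : ℝ, 0 < t ∧ F ((c : ℂ) + (t : ℂ) * Complex.I) ≠ 0 := by
    have hcont : Continuous fun s : ℝ => F ((c : ℂ) + (s : ℂ) * Complex.I) := by fun_prop
    have h0 : F ((c : ℂ) + ((0 : ℝ) : ℂ) * Complex.I) ≠ 0 := by simpa using hc
    have hev : ∀ᶠ s : ℝ in 𝓝 0, F ((c : ℂ) + (s : ℂ) * Complex.I) ≠ 0 :=
      hcont.continuousAt.eventually_ne h0
    have hev' : ∀ᶠ s : ℝ in 𝓝[>] 0, F ((c : ℂ) + (s : ℂ) * Complex.I) ≠ 0 ∧ s ∈ Ioi (0 : ℝ) :=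
      (hev.filter_mono nhdsWithin_le_nhds).and self_mem_nhdsWithin
    obtain ⟨s, hs1, hs2⟩ := hev'.exists
    exact ⟨s, hs2, hs1⟩
  -- Step 1: `G = F e^{iBz}`
  set G : ℂ → ℂ := fun z => F z * Complex.exp (Complex.I * B * z) with hGdef
  have hGd : Differentiable ℂ G := by
    rw [hGdef]
    fun_prop
  have hGK : ∀ z : ℂ, 0 < z.im → ‖G z‖ ≤ K := fun z hz => norm_mul_exp_le hFb hz.le
  have hGreal : ∀ x : ℝ, ‖G (x : ℂ)‖ = ‖F (x : ℂ)‖ := fun x => norm_mul_exp_ofReal F B x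
  have hGct : G ((c : ℂ) + (t : ℂ) * Complex.I) ≠ 0 := mul_ne_zero hct (Complex.exp_ne_zero _)
  set a : ℝ := ‖G ((c : ℂ) + (t : ℂ) * Complex.I)‖ ^ 2 with ha_def
  have ha : 0 < a := by
    have := norm_pos_iff.2 hGct
    positivity
  -- the boundary data `q σ = |F(c - tσ)|²`
  set q : ℝ → ℝ := fun σ => ‖F ((c - t * σ : ℝ) : ℂ)‖ ^ 2 with hq_def
  have hqc : Continuous q := by
    rw [hq_def]
    fun_prop
  have hq0 : ∀ σ, 0 ≤ q σ := fun σ => sq_nonneg _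
  have hqQ : ∀ σ, q σ ≤ K ^ 2 := fun σ => by
    have h := hFb ((c - t * σ : ℝ) : ℂ)
    rw [Complex.ofReal_im, abs_zero, mul_zero, Real.exp_zero, mul_one] at h
    exact pow_le_pow_left₀ (norm_nonneg _) h 2
  -- Steps 2–4: the `ε`-uniform bound
  have hbound : ∀ ε : ℝ, 0 < ε → ε ≤ 1 →
      ∫ σ, Real.posLog (q σ + ε)⁻¹ / (1 + σ ^ 2) ≤
        π * Real.posLog (K ^ 2 + 1) - π * Real.log a := by
    intro ε hε hε1
    apply integral_posLog_inv_le hqc hq0 hqQ ha hε hε1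
    have h := log_normSq_add_le_upperHalfPlane hGd hGK c ht hε
    simpa only [hGreal] using h
  -- Step 5: Fatou
  have hint : Integrable (fun σ => Real.posLog (q σ)⁻¹ / (1 + σ ^ 2)) :=
    integrable_posLog_inv_of_bound hqc hq0 fun n => hbound _ (by positivity) (by
      rw [div_le_one (by positivity)]
      linarith [(n.cast_nonneg : (0 : ℝ) ≤ n)])
  have hP2 : ∀ x : ℝ, Real.posLog (‖F (x : ℂ)‖ ^ 2)⁻¹ = 2 * Real.posLog ‖F (x : ℂ)‖⁻¹ := by
    intro x
    rw [← inv_pow, Real.posLog_pow]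
    norm_num
  have hint' : Integrable (fun σ => Real.posLog ‖F ((c - t * σ : ℝ) : ℂ)‖⁻¹ / (1 + σ ^ 2)) := by
    refine (hint.div_const 2).congr (ae_of_all _ fun σ => ?_)
    simp only [hq_def, hP2]
    ring
  -- Step 6: back to the variable `x = c - tσ`
  have hPm : Measurable fun x : ℝ => Real.posLog ‖F (x : ℂ)‖⁻¹ :=
    Real.continuous_posLog.measurable.comp (hFc.comp Complex.continuous_ofReal).norm.measurable.inv
  exact integrable_div_one_add_sq_of_affine hPm (fun x => Real.posLog_nonneg) c ht.ne' hint'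

end Summit.RiemannHypothesis.RiemannHypothesis.Theorems.SpectralTraceWindowStep
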